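import Literature.LinearAlgebra.Matrix.PermanentEqualRows
import HarnessLib

/-!
# Stub `stub_permanent_two_equal_rows` of line `Sketch` (xp-ladder-middle-bits), crux `PermanentNotInP` (stmt-PneNP-16143)

Side stub (c2) of the route `PermanentDescent`: the algebraic engine of Valiant's polynomial-time
algorithm for the permanent modulo `2^k` (L. G. Valiant, *The complexity of computing the
permanent*, TCS 8 (1979), Thm. 3 and its proof). If rows `a` and `a.succAbove p` of an
`(n+2) × (n+2)` matrix over a commutative semiring agree, its permanent is TWICE the sum, over
the column pairs `b < b''` (encoded as `(b, b')` with `b'' = b.succAbove b'` and `b ≤ b'` as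
naturals), of `B a b · B a b'' · per (minor)`, the minor deleting the two equal rows and the two
columns. The mathematics lives in `Literature/LinearAlgebra/Matrix/PermanentEqualRows.lean`
(`Literature.LinearAlgebra.Matrix.permanent_eq_two_mul_sum_of_row_eq`: ordered double Laplace
expansion along the two equal rows, then the pair-swap involution
`(b, b') ↦ (b.succAbove b', b'.predAbove b)`); this file is the registered restatement.

References: L. G. Valiant, *The complexity of computing the permanent*, Theoret. Comput. Sci. 8
(1979) 189–201, Thm. 3 (proof).
-/

-- the single-problem summit repeats `PneNP.PneNP` in module path and namespace (justified lint debt)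
set_option linter.dupNamespace false

namespace Summit.PneNP.PneNP.Theorems.XpLadder

/-- **Side stub `stub_permanent_two_equal_rows` (c2): the engine of Valiant's `perm mod 2^k`
algorithm** — if rows `a` and `a.succAbove p` of a square matrix agree, its permanent is TWICE
the sum, over column pairs `b < b''` (`b'' = b.succAbove b'` with `b ≤ b'`), of
`B a b · B a b'' · perm(minor)`, the minor deleting the two equal rows and the two columns
(double Laplace expansion along the equal rows, then symmetry of the unordered pair;
`Literature.LinearAlgebra.Matrix.permanent_eq_two_mul_sum_of_row_eq`). [cite: Valiant1979, Thm. 3 (proof)] -/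
theorem stub_permanent_two_equal_rows :
    ∀ {R : Type} [CommSemiring R] {n : ℕ} (B : Matrix (Fin (n + 2)) (Fin (n + 2)) R)
      (a : Fin (n + 2)) (p : Fin (n + 1)), B a = B (a.succAbove p) →
      B.permanent = 2 * ∑ b : Fin (n + 2), ∑ b' : Fin (n + 1),
        if (b : ℕ) ≤ (b' : ℕ) then
          B a b * B a (b.succAbove b') *
            (B.submatrix (a.succAbove ∘ p.succAbove) (b.succAbove ∘ b'.succAbove)).permanent
        else 0 :=
  fun B a p h => Literature.LinearAlgebra.Matrix.permanent_eq_two_mul_sum_of_row_eq B a p h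

end Summit.PneNP.PneNP.Theorems.XpLadder
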